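import Mathlib
import HarnessLib
import Literature.Analysis.FluidPDE.Tao2016AveragedNS.LocalCascadeSolutions
import Literature.Analysis.FluidPDE.Tao2016AveragedNS.RenormalisedCascadeWaves
import Literature.Analysis.FluidPDE.Tao2016AveragedNS.SelfSimilarCascadeBlowup
import Literature.Analysis.FluidPDE.Tao2016AveragedNS.ViscousEternalSolutions
import Literature.Analysis.FluidPDE.Tao2016AveragedNS.BoundedEternalSolutions
import Summits.NavierStokesRegularity.NavierStokesRegularity.Theses.TaoLadderRungTwoBreak
import Summits.NavierStokesRegularity.NavierStokesRegularity.Theorems.TaoLadderRungTwoBreakNoSurvivingEternalViscBddOneSurvivorTailGrowth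

/-!
# The `1/ε₀` amplitude floor of bounded survivors, TAIL FORM (II): SURVIVORS STAY TALL — crux K1ᵛ(1)
# `TaoLadderRungTwoBreak.NoSurvivingEternalViscBddOne` ⟨20419⟩ (children (ρ0) ⟨20451⟩ / (ρ+) ⟨20452⟩)

MODEL lattice ODEs only (Tao 2016 §4, §6.4; cell vocabulary `IsEternalVisc`, `UniformBound`, `EternalSurvivingFwd`); nothing here is a
statement about the Navier–Stokes equations; no stub, crux or summit is closed (`--supports stmt-NavierStokesRegularity-20419`).

The shell shift `(n, σ) ↦ (n + d, σ + 2d·log(1+ε₀))` preserves admissible eternal solutions (tree `isEternalVisc_shift`) AND forward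
(S₁)-survival (`survivingFwd_shift`: the a=1 weight `physWeight 1 ε₀ = (1+ε₀)^{−4}` is exactly compensated).  Shifting the tail
`k ≥ n₀` down to `k ≥ 0` and applying `survivor_amplitude_floor_tail0`:
* **`survivor_amplitude_floor_tail`** — a uniformly bounded, forward-(S₁)-surviving admissible eternal solution (any `ν̂ ≥ 0`) of a
  cancelling table with `‖W_k(σ)‖ ≤ B` on a TAIL `k ≥ n₀` satisfies `4Λ ≤ 7·C_A·B·(Λ²−1)` — for every `n₀`;
* `survivor_tall_io` — on `InTableClass R`: `‖W_k(σ)‖ > Λ/(113(Λ²−1)) ≈ 1/(565ε₀)` for shells `k` ARBITRARILY HIGH (survivors never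
  flatten: `limsup_k sup_σ ‖W_k(σ)‖ ≥ Λ/(113(Λ²−1))`);
* `noSurvivingEternalViscBddOne_onTailSlice` — K1ᵛ(1) (hence (ρ0) and (ρ+)) HOLDS, for `0 < ε₀ ≤ min 1 (1/(6944B))`, all `R`, all
  `ν̂ ≥ 0`, on the class of uniformly bounded admissible eternal solutions whose amplitude is EVENTUALLY (in the shell) `≤ B`.
READING for ⟨20419⟩: what remains is to exclude survivors that are tall (`≳ 1/(565ε₀)`) on arbitrarily high shells, uniformly in
the table — the ω-limit objects of the crux are genuinely large-amplitude («slow clock») on every tail.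
HONEST LABEL: (ρ0), (ρ+), ⟨20419⟩ and every NS statement remain OPEN; rung 0.
-/

noncomputable section

-- the summit and its single sub-problem share the name (CONVENTIONS §1)
set_option linter.dupNamespace false

namespace Summit.NavierStokesRegularity.NavierStokesRegularity.Theorems.NoSurvivingEternalViscBddOne.SurvivorTailFloor

open Set Filter Topology MeasureTheory
open scoped RealInnerProductSpace
open Literature.Analysis.FluidPDE Literature.Analysis.FluidPDE.TaoCascade
open Summit.NavierStokesRegularity.NavierStokesRegularity.Theses.TaoLadderRungTwoBreak
open Summit.NavierStokesRegularity.NavierStokesRegularity.Theorems.NoSurvivingEternalViscBddOne.SmallAction (fluxConst_le_64)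
open Summit.NavierStokesRegularity.NavierStokesRegularity.Theorems.NoSurvivingEternalViscBddOne.SurvivorTailGrowth

variable {m : ℕ} {ε₀ νh : ℝ} {α : Fin m → Fin m → Fin m → ℤ × ℤ × ℤ → ℝ} {W : ℤ → ℝ → Em m}

/-! ## §1 Survival is shift-covariant -/

/-- The a=1 physical weight is `(1+ε₀)^{-4}`. [cite: Tao2016AveragedNS, §4 (4.1) (scale weights); cell vocabulary `physWeight`] -/
theorem physWeight_one (hε : 0 < ε₀) : physWeight 1 ε₀ = ((1 + ε₀) ^ 4)⁻¹ := by
  have hx : 0 < 1 + ε₀ := by linarith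
  unfold physWeight
  rw [Real.rpow_one]
  field_simp

/-- **Forward (S₁)-survival is invariant under the covariant shell shift** `(n, σ) ↦ (n + d, σ + 2d·log(1+ε₀))` (`d ≥ 0`): the
weight `physWeight 1 ε₀ = (1+ε₀)^{−4}` per shell is exactly compensated by `e^{2·2d·log(1+ε₀)} = (1+ε₀)^{4d}`.
[cite: Tao2016AveragedNS, §3 (remark after Def. 3.1: dyadic scale invariance), §4 (4.1), §6.4; cell vocabulary; tree `isEternalVisc_shift`] -/
theorem survivingFwd_shift (hε : 0 < ε₀) (hS : EternalSurvivingFwd 1 ε₀ W) (d : ℕ) :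
    EternalSurvivingFwd 1 ε₀ (fun n σ => W (n + (d : ℤ)) (σ + 2 * ((d : ℤ) : ℝ) * Real.log (1 + ε₀))) := by
  have hx : 0 < 1 + ε₀ := by linarith
  set ℓ : ℝ := Real.log (1 + ε₀) with hℓ
  have hℓ0 : 0 ≤ ℓ := Real.log_nonneg (by linarith)
  obtain ⟨c, hc, H⟩ := hS
  refine ⟨c, hc, fun N => ?_⟩
  obtain ⟨K, hK⟩ := exists_nat_ge (2 * (d : ℝ) * ℓ)
  obtain ⟨n, hn, σ, hσ, hle⟩ := H (N + d + K)
  have hdn : d ≤ n := by omega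
  refine ⟨n - d, by omega, σ - 2 * (d : ℝ) * ℓ, ?_, ?_⟩
  · have h1 : ((N + d + K : ℕ) : ℝ) ≤ σ := hσ
    push_cast at h1
    have h2 : (0 : ℝ) ≤ (d : ℝ) := Nat.cast_nonneg d
    linarith
  · have hidx : (((n - d : ℕ) : ℤ) + (d : ℤ)) = (n : ℤ) := by push_cast [Nat.cast_sub hdn]; ring
    have hcast : ((d : ℤ) : ℝ) = (d : ℝ) := by norm_cast
    have htime : σ - 2 * (d : ℝ) * ℓ + 2 * ((d : ℤ) : ℝ) * ℓ = σ := by rw [hcast]; ring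
    simp only [hidx, htime]
    -- the weights: `pw^{n-d} e^{2(σ - 2dℓ)} = pw^n e^{2σ}`
    have hpw : physWeight 1 ε₀ = ((1 + ε₀) ^ 4)⁻¹ := physWeight_one hε
    have hexp : Real.exp (2 * (σ - 2 * (d : ℝ) * ℓ)) = Real.exp (2 * σ) * physWeight 1 ε₀ ^ d := by
      rw [hpw, inv_pow, ← pow_mul, show 2 * (σ - 2 * (d : ℝ) * ℓ) = 2 * σ - ((4 * d : ℕ) : ℝ) * ℓ by push_cast; ring,
        Real.exp_sub, Real.exp_nat_mul, hℓ, Real.exp_log hx, div_eq_mul_inv]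
    have hw : physWeight 1 ε₀ ^ (n - d) * Real.exp (2 * (σ - 2 * (d : ℝ) * ℓ))
        = physWeight 1 ε₀ ^ n * Real.exp (2 * σ) := by
      rw [hexp, show physWeight 1 ε₀ ^ (n - d) * (Real.exp (2 * σ) * physWeight 1 ε₀ ^ d)
        = (physWeight 1 ε₀ ^ (n - d) * physWeight 1 ε₀ ^ d) * Real.exp (2 * σ) by ring, pow_sub_mul_pow _ hdn]
    calc c ≤ physWeight 1 ε₀ ^ n * (Real.exp (2 * σ) * ‖W n σ‖ ^ 2) := hle
      _ = physWeight 1 ε₀ ^ (n - d) * (Real.exp (2 * (σ - 2 * (d : ℝ) * ℓ)) * ‖W n σ‖ ^ 2) := by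
        rw [← mul_assoc, ← mul_assoc, hw]

/-! ## §2 The floor on every tail -/

/-- **THE `1/ε₀` AMPLITUDE FLOOR ON EVERY TAIL.**  A uniformly bounded, forward-(S₁)-surviving admissible eternal solution (any
`ν̂ ≥ 0`) of a CANCELLING table with `‖W_k(σ)‖ ≤ B` for all shells `k ≥ n₀` (ANY `n₀`) satisfies `4Λ ≤ 7·C_A·B·(Λ²−1)`: shift the
tail down to `k ≥ 0` (`isEternalVisc_shift`, `survivingFwd_shift`) and apply `survivor_amplitude_floor_tail0`.
[cite: Tao2016AveragedNS, §4 Lemma 4.1 (4.8)–(4.10) with (4.3), the viscous equation before Thm. 4.2, §6.4; this file] -/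
theorem survivor_amplitude_floor_tail (hε : 0 < ε₀) (hW : IsEternalVisc ε₀ νh α W) (hc : IsCancellingCoeff α)
    (hU : UniformBound W) (n₀ : ℕ) {B : ℝ} (hB : ∀ k : ℤ, (n₀ : ℤ) ≤ k → ∀ σ, ‖W k σ‖ ≤ B)
    (hS : EternalSurvivingFwd 1 ε₀ W) :
    4 * bigLam ε₀ ≤ 7 * fluxConst α * B * (bigLam ε₀ ^ 2 - 1) := by
  set W' : ℤ → ℝ → Em m := fun n σ => W (n + (n₀ : ℤ)) (σ + 2 * ((n₀ : ℤ) : ℝ) * Real.log (1 + ε₀)) with hW'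
  have hW'e : IsEternalVisc ε₀ νh α W' := isEternalVisc_shift (by linarith) hW (n₀ : ℤ)
  obtain ⟨C, hC⟩ := hU
  have hU' : UniformBound W' := ⟨C, fun k σ => hC _ _⟩
  have hB' : ∀ k : ℤ, 0 ≤ k → ∀ σ, ‖W' k σ‖ ≤ B := fun k hk σ => hB _ (by omega) _
  have hS' : EternalSurvivingFwd 1 ε₀ W' := survivingFwd_shift hε hS n₀
  exact survivor_amplitude_floor_tail0 hε hW'e hc hU' hB' hS'

/-- **On a table of `InTableClass R`** (`C_A ≤ 64`): a tail bound `‖W_k‖ ≤ B` (`k ≥ n₀`) of a uniformly bounded (S₁)-survivor obeys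
`Λ ≤ 112·B·(Λ²−1)`, for every `n₀`.
[cite: Tao2016AveragedNS, §4 Thm. 4.2 (statement shape), §6.4; this file; tree `fluxConst_le_64`] -/
theorem survivor_amplitude_floor_tail_inTableClass {R : ℝ} (hε : 0 < ε₀) {α : Fin 4 → Fin 4 → Fin 4 → ℤ × ℤ × ℤ → ℝ}
    (hα : InTableClass R α) {W : ℤ → ℝ → Em 4} (hW : IsEternalVisc ε₀ νh α W) (hU : UniformBound W)
    (n₀ : ℕ) {B : ℝ} (hB : ∀ k : ℤ, (n₀ : ℤ) ≤ k → ∀ σ, ‖W k σ‖ ≤ B) (hS : EternalSurvivingFwd 1 ε₀ W) :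
    bigLam ε₀ ≤ 112 * B * (bigLam ε₀ ^ 2 - 1) := by
  have h := survivor_amplitude_floor_tail hε hW hα.2.1 hU n₀ hB hS
  have hC := fluxConst_le_64 hα
  have hB0 : 0 ≤ B := (norm_nonneg _).trans (hB n₀ le_rfl 0)
  have hΛ1 : 1 < bigLam ε₀ := by unfold bigLam; exact Real.one_lt_rpow (by linarith) (by norm_num)
  have hΛ2 : 0 ≤ bigLam ε₀ ^ 2 - 1 := by nlinarith
  have h2 : 7 * fluxConst α * B * (bigLam ε₀ ^ 2 - 1) ≤ 7 * 64 * B * (bigLam ε₀ ^ 2 - 1) := by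
    have := mul_le_mul_of_nonneg_right (mul_le_mul_of_nonneg_right hC hB0) hΛ2
    nlinarith
  nlinarith

/-- **SURVIVORS STAY TALL.**  A uniformly bounded forward-(S₁)-surviving admissible eternal solution (any `ν̂ ≥ 0`) of a table of
`InTableClass R` has, on ARBITRARILY HIGH shells, renormalised amplitude `> Λ/(113(Λ²−1)) ≈ 1/(565ε₀)`:
`limsup_k sup_σ ‖W_k(σ)‖ ≥ Λ/(113(Λ²−1))`.
[cite: Tao2016AveragedNS, §4 Thm. 4.2 (statement shape), §6.4; this file] -/
theorem survivor_tall_io {R : ℝ} (hε : 0 < ε₀) {α : Fin 4 → Fin 4 → Fin 4 → ℤ × ℤ × ℤ → ℝ}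
    (hα : InTableClass R α) {W : ℤ → ℝ → Em 4} (hW : IsEternalVisc ε₀ νh α W) (hU : UniformBound W)
    (hS : EternalSurvivingFwd 1 ε₀ W) (n₀ : ℕ) :
    ∃ k : ℤ, (n₀ : ℤ) ≤ k ∧ ∃ σ : ℝ, bigLam ε₀ / (113 * (bigLam ε₀ ^ 2 - 1)) < ‖W k σ‖ := by
  by_contra hno
  push Not at hno
  have hΛ1 : 1 < bigLam ε₀ := by unfold bigLam; exact Real.one_lt_rpow (by linarith) (by norm_num)
  have hΛ2 : 0 < bigLam ε₀ ^ 2 - 1 := by nlinarith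
  have h := survivor_amplitude_floor_tail_inTableClass hε hα hW hU n₀ (fun k hk σ => hno k hk σ) hS
  have e : 112 * (bigLam ε₀ / (113 * (bigLam ε₀ ^ 2 - 1))) * (bigLam ε₀ ^ 2 - 1) = 112 / 113 * bigLam ε₀ := by
    field_simp
  rw [e] at h
  linarith

/-! ## §3 The slice theorem on eventual amplitude -/

/-- `(1+ε)⁵ − 1 ≤ 31ε` on `[0,1]`. [folklore] -/
private theorem pow_five_sub_one_le' {ε : ℝ} (h0 : 0 ≤ ε) (h1 : ε ≤ 1) : (1 + ε) ^ 5 - 1 ≤ 31 * ε := by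
  have h2 : ε ^ 2 ≤ ε := by nlinarith
  have h3 : ε ^ 3 ≤ ε := by nlinarith
  have h4 : ε ^ 4 ≤ ε := by nlinarith
  have h5 : ε ^ 5 ≤ ε := by nlinarith
  nlinarith

/-- **K1ᵛ(1) ON THE EVENTUAL-AMPLITUDE SLICE.**  For every `B > 0` and ALL `0 < ε₀ ≤ min 1 (1/(6944B))`, all `R`, all tables of
`InTableClass R`, all `ν̂ ≥ 0`: no uniformly bounded admissible eternal solution whose amplitude is EVENTUALLY `≤ B` (on some tail
`k ≥ n₀`) is forward (S₁)-surviving.  Both split children at once ((ρ0) `ν̂ = 0`, (ρ+) `ν̂ > 0`); the crux ⟨20419⟩ is this with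
the threshold independent of `B`.
[cite: Tao2016AveragedNS, §4 Thm. 4.2 (statement shape), §6.4; this file] -/
theorem noSurvivingEternalViscBddOne_onTailSlice {B : ℝ} (hBpos : 0 < B) :
    ∀ ε₀ : ℝ, 0 < ε₀ → ε₀ ≤ min 1 (1 / (6944 * B)) →
      ∀ (R : ℝ) (α : Fin 4 → Fin 4 → Fin 4 → ℤ × ℤ × ℤ → ℝ), InTableClass R α →
        ∀ (νh : ℝ) (W : ℤ → ℝ → Em 4), IsEternalVisc ε₀ νh α W → UniformBound W →
          (∃ n₀ : ℕ, ∀ k : ℤ, (n₀ : ℤ) ≤ k → ∀ σ, ‖W k σ‖ ≤ B) → ¬ EternalSurvivingFwd 1 ε₀ W := by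
  intro ε₀ hε hle R α hα νh W hW hU htail hS
  obtain ⟨n₀, hB⟩ := htail
  have hε1 : ε₀ ≤ 1 := hle.trans (min_le_left _ _)
  have hεB : ε₀ ≤ 1 / (6944 * B) := hle.trans (min_le_right _ _)
  have hΛ1 : 1 ≤ bigLam ε₀ := one_le_bigLam hε.le
  have h := survivor_amplitude_floor_tail_inTableClass hε hα hW hU n₀ hB hS
  rw [bigLam_sq hε.le] at h
  have h1 : (1 + ε₀) ^ 5 - 1 ≤ 31 * ε₀ := pow_five_sub_one_le' hε.le hε1
  have h2 : 112 * B * ((1 + ε₀) ^ 5 - 1) ≤ 112 * B * (31 * ε₀) := mul_le_mul_of_nonneg_left h1 (by positivity)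
  have h3 : 6944 * B * ε₀ ≤ 1 := by
    rw [le_div_iff₀ (by positivity)] at hεB
    linarith
  nlinarith

/-! ## §4 The residual form of the crux (appended) -/

/-- **THE CRUX ⟨20419⟩ IN RESIDUAL FORM.**  `NoSurvivingEternalViscBddOne` is EQUIVALENT to its restriction to solutions that are TALL ON
EVERY TAIL: it suffices to show that, below a threshold, no uniformly bounded admissible eternal solution (any `ν̂ ≥ 0`) of a table of
`InTableClass R` which has `‖W_k(σ)‖ > Λ/(113(Λ²−1))` on arbitrarily high shells `k` is forward (S₁)-surviving — every other candidate
is already excluded by `survivor_tall_io`.  (What a content seat has to kill: large-amplitude objects, `≳ 1/(565ε₀)`, recurring in the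
shell.)
[cite: Tao2016AveragedNS, §4 Thm. 4.2 (statement shape), §6.4; this file] -/
theorem noSurvivingEternalViscBddOne_iff_tallResidual :
    NoSurvivingEternalViscBddOne ↔
      ∀ R : ℝ, 1 ≤ R → ∃ εs : ℝ, 0 < εs ∧ ∀ ε₀ : ℝ, 0 < ε₀ → ε₀ ≤ εs →
        ∀ α : Fin 4 → Fin 4 → Fin 4 → ℤ × ℤ × ℤ → ℝ, InTableClass R α →
          ∀ (νh : ℝ) (W : ℤ → ℝ → Em 4), IsEternalVisc ε₀ νh α W → UniformBound W →
            (∀ n₀ : ℕ, ∃ k : ℤ, (n₀ : ℤ) ≤ k ∧ ∃ σ : ℝ, bigLam ε₀ / (113 * (bigLam ε₀ ^ 2 - 1)) < ‖W k σ‖) →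
              ¬ EternalSurvivingFwd 1 ε₀ W := by
  constructor
  · intro h R hR
    obtain ⟨εs, hεs, H⟩ := h R hR
    exact ⟨εs, hεs, fun ε₀ hε₀ hle α hα νh W hW hU _ => H ε₀ hε₀ hle α hα νh W hW hU⟩
  · intro h R hR
    obtain ⟨εs, hεs, H⟩ := h R hR
    refine ⟨εs, hεs, fun ε₀ hε₀ hle α hα νh W hW hU hS => ?_⟩
    exact H ε₀ hε₀ hle α hα νh W hW hU (survivor_tall_io hε₀ hα hW hU hS) hS

/-- **The same for the inviscid child (ρ0)** `NoSurvivingEternalBddOne` ⟨20451⟩ (`IsEternal` = `IsEternalVisc` with `ν̂ = 0`).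
[cite: Tao2016AveragedNS, §4 Thm. 4.2 (statement shape), §6.4; this file; tree `IsEternal.isEternalVisc`] -/
theorem noSurvivingEternalBddOne_iff_tallResidual :
    NoSurvivingEternalBddOne ↔
      ∀ R : ℝ, 1 ≤ R → ∃ εs : ℝ, 0 < εs ∧ ∀ ε₀ : ℝ, 0 < ε₀ → ε₀ ≤ εs →
        ∀ α : Fin 4 → Fin 4 → Fin 4 → ℤ × ℤ × ℤ → ℝ, InTableClass R α →
          ∀ W : ℤ → ℝ → Em 4, IsEternal ε₀ α W → UniformBound W →
            (∀ n₀ : ℕ, ∃ k : ℤ, (n₀ : ℤ) ≤ k ∧ ∃ σ : ℝ, bigLam ε₀ / (113 * (bigLam ε₀ ^ 2 - 1)) < ‖W k σ‖) →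
              ¬ EternalSurvivingFwd 1 ε₀ W := by
  constructor
  · intro h R hR
    obtain ⟨εs, hεs, H⟩ := h R hR
    exact ⟨εs, hεs, fun ε₀ hε₀ hle α hα W hW hU _ => H ε₀ hε₀ hle α hα W hW hU⟩
  · intro h R hR
    obtain ⟨εs, hεs, H⟩ := h R hR
    refine ⟨εs, hεs, fun ε₀ hε₀ hle α hα W hW hU hS => ?_⟩
    exact H ε₀ hε₀ hle α hα W hW hU (survivor_tall_io hε₀ hα hW.isEternalVisc hU hS) hS

end Summit.NavierStokesRegularity.NavierStokesRegularity.Theorems.NoSurvivingEternalViscBddOne.SurvivorTailFloor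

end
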